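import Mathlib
import Literature.Computability.Complexity.Circuit
import Literature.Computability.Complexity.KWProtocol
import HarnessLib

/-!
# Upper bounds for monotone Karchmer–Wigderson games: the trivial protocols

Folklore protocols for the MONOTONE Karchmer–Wigderson game of `h : (ι → Bool) → Bool`
(Alice holds `a ∈ h⁻¹(1)`, Bob `b ∈ h⁻¹(0)`, goal: a coordinate `i` with `a i = 1`, `b i = 0`),
over the protocol trees `KWTree` of `Literature/Computability/Complexity/KWProtocol.lean`:

* `KWTree.exists_solvesMono_of_choice` — the abstract two-phase scheme "Alice names a term,
  Bob names a coordinate of it" behind the next two;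
* `KWTree.exists_solvesMono_of_terms` — the **DNF protocol**: if `h` is the disjunction over a
  family `𝒯` of at most `2^k` terms `⋀_{i ∈ T} x_i`, each of at most `2^t` variables, then Alice
  names a term satisfied by `a` (`k` bits) and Bob names a variable of that term which is `0` in
  `b` (`t` bits): depth `≤ k + t` (Karchmer–Wigderson 1990, §2; Jukna 2012, §3.3, the upper bound
  `C(R_f^m) ≤ log₂(#minterms) + log₂(max minterm)`);
* `KWTree.exists_solvesMono_of_narrow_terms` — the same in WIDTH form: terms of at most `d` of
  the `N` variables, Alice names her term as a `d`-tuple over `N + 1` symbols: depth `≤ k + t`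
  whenever `(N+1)^d ≤ 2^k`, `N ≤ 2^t` (so `≤ d ⌈log₂(N+1)⌉ + ⌈log₂ N⌉`);
* `KWTree.exists_solvesMono_of_monotone` — the **send-your-input protocol**: for every monotone
  `h` on `N` coordinates, Alice sends `a` (`N` bits) and Bob names a coordinate with `a i = 1`,
  `b i = 0` (`⌈log₂ N⌉` bits), which exists by monotonicity: depth `≤ N + t` whenever `N ≤ 2^t`.

All are stated with an abstract `h` characterised by a hypothesis (`hh`, resp. `Monotone h`) so
that users may instantiate `h` by any `decide`-spelling of the same Boolean function.

References: M. Karchmer, A. Wigderson, SIAM J. Discrete Math. 3 (1990), §2; S. Jukna, *Boolean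
Function Complexity* (2012), §3.3.
-/

namespace Literature.Computability.Complexity

universe u


namespace KWTree

variable {ι : Type u}

/-! ### The DNF protocol -/

/-- **Abstract two-phase protocol.** Suppose Alice can compute from `a ∈ h⁻¹(1)` a number
`cA a < 2^k` naming a "term" `term (cA a)` all of whose coordinates are `1` in `a` and which is not
contained in the `1`-set of any `b ∈ h⁻¹(0)`, and Bob can compute from `b` and a term number `j`
a number `cB j b < 2^t` naming (through `elt j`) a coordinate of the term that is `0` in `b`. Then
"Alice sends `cA a`, Bob sends `cB (cA a) b`" solves the monotone KW game of `h` in depth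
`≤ k + t`. [cite: KarchmerWigderson1990, §2 (the protocol for a DNF)] -/
theorem exists_solvesMono_of_choice (h : (ι → Bool) → Bool) (k t : ℕ)
    (term : ℕ → Finset ι) (cA : (ι → Bool) → ℕ) (cB : ℕ → (ι → Bool) → ℕ) (elt : ℕ → ℕ → ι)
    (hA : ∀ a, h a = true → cA a < 2 ^ k ∧ ∀ i ∈ term (cA a), a i = true)
    (hAB : ∀ a b, h a = true → h b = false → ∃ i ∈ term (cA a), b i = false)
    (hB : ∀ j b, (∃ i ∈ term j, b i = false) →
      cB j b < 2 ^ t ∧ elt j (cB j b) ∈ term j ∧ b (elt j (cB j b)) = false) :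
    ∃ P : KWTree ι, P.SolvesMono h ∧ P.depth ≤ k + t := by
  refine ⟨aliceChoose k cA fun j => bobChoose t (cB j) fun l => leaf (elt j l), ?_, ?_⟩
  · intro a b ha hb
    obtain ⟨hlt, hall⟩ := hA a ha
    obtain ⟨hBlt, hBmem, hBfalse⟩ := hB (cA a) b (hAB a b ha hb)
    rw [run_aliceChoose k cA _ a b hlt, run_bobChoose t (cB (cA a)) _ a b hBlt, run_leaf]
    exact ⟨hall _ hBmem, hBfalse⟩
  · refine depth_aliceChoose_le k cA _ t fun j _ => ?_
    simpa using depth_bobChoose_le t (cB j) (fun l => leaf (elt j l)) 0 fun l _ => by simp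

/-- **The DNF protocol** (Karchmer–Wigderson 1990, §2; Jukna 2012, §3.3): if `h` is the
disjunction of the terms `⋀_{i ∈ T} x_i`, `T ∈ 𝒯`, with `#𝒯 ≤ 2^k` and every `#T ≤ 2^t`, then
the monotone KW game of `h` has a protocol of depth `≤ k + t`: Alice names a term all of whose
variables are `1` in `a`, Bob names a variable of that term which is `0` in `b`.
[cite: KarchmerWigderson1990, §2] [cite: JuknaBFC2012, §3.3] -/
theorem exists_solvesMono_of_terms [Nonempty ι] (𝒯 : Finset (Finset ι))
    (h : (ι → Bool) → Bool) (hh : ∀ a, h a = true ↔ ∃ T ∈ 𝒯, ∀ i ∈ T, a i = true) (k t : ℕ)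
    (hk : 𝒯.card ≤ 2 ^ k) (ht : ∀ T ∈ 𝒯, T.card ≤ 2 ^ t) :
    ∃ P : KWTree ι, P.SolvesMono h ∧ P.depth ≤ k + t := by
  classical
  -- enumerate the terms and, inside each term, its coordinates
  let e := 𝒯.equivFin
  let term : ℕ → Finset ι := fun j => if hj : j < 𝒯.card then (e.symm ⟨j, hj⟩ : Finset ι) else ∅
  let elt : ℕ → ℕ → ι := fun j l =>
    if hl : l < (term j).card then ((term j).equivFin.symm ⟨l, hl⟩ : ι) else Classical.arbitrary ι
  let cB : ℕ → (ι → Bool) → ℕ := fun j b =>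
    if hb : ∃ i ∈ term j, b i = false then
      ((term j).equivFin ⟨Classical.choose hb, (Classical.choose_spec hb).1⟩ : ℕ) else 0
  let cA : (ι → Bool) → ℕ := fun a =>
    if ha : ∃ T ∈ 𝒯, ∀ i ∈ T, a i = true then
      (e ⟨Classical.choose ha, (Classical.choose_spec ha).1⟩ : ℕ) else 0
  -- Alice's term
  have hAterm : ∀ a (ha : ∃ T ∈ 𝒯, ∀ i ∈ T, a i = true),
      cA a < 2 ^ k ∧ term (cA a) = Classical.choose ha := by
    intro a ha
    have hcA : cA a = (e ⟨Classical.choose ha, (Classical.choose_spec ha).1⟩ : ℕ) := by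
      simp only [cA, dif_pos ha]
    refine ⟨?_, ?_⟩
    · rw [hcA]
      exact lt_of_lt_of_le (Fin.isLt _) hk
    · have hlt : cA a < 𝒯.card := by rw [hcA]; exact Fin.isLt _
      simp only [term, dif_pos hlt]
      have : (⟨cA a, hlt⟩ : Fin 𝒯.card) = e ⟨Classical.choose ha, (Classical.choose_spec ha).1⟩ :=
        Fin.ext hcA
      rw [this, Equiv.symm_apply_apply]
  refine exists_solvesMono_of_choice h k t term cA cB elt ?_ ?_ ?_
  · intro a ha
    have ha' := (hh a).mp ha
    obtain ⟨hlt, hterm⟩ := hAterm a ha'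
    refine ⟨hlt, ?_⟩
    rw [hterm]
    exact (Classical.choose_spec ha').2
  · intro a b ha hb
    have ha' := (hh a).mp ha
    obtain ⟨-, hterm⟩ := hAterm a ha'
    rw [hterm]
    by_contra hcon
    push Not at hcon
    have hb' : h b = true :=
      (hh b).mpr ⟨_, (Classical.choose_spec ha').1, fun i hi => by simpa using hcon i hi⟩
    rw [hb] at hb'
    exact Bool.false_ne_true hb'
  · intro j b hb
    have hcB : cB j b = ((term j).equivFin ⟨Classical.choose hb, (Classical.choose_spec hb).1⟩ : ℕ) := by
      simp only [cB, dif_pos hb]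
    have hlt : cB j b < (term j).card := by rw [hcB]; exact Fin.isLt _
    have helt : elt j (cB j b) = Classical.choose hb := by
      simp only [elt, dif_pos hlt]
      have : (⟨cB j b, hlt⟩ : Fin (term j).card) =
          (term j).equivFin ⟨Classical.choose hb, (Classical.choose_spec hb).1⟩ := Fin.ext hcB
      rw [this, Equiv.symm_apply_apply]
    refine ⟨?_, ?_, ?_⟩
    · -- the term is one of `𝒯` (else it would be empty), so its size is at most `2^t`
      have hj : j < 𝒯.card := by
        by_contra hj
        have : term j = ∅ := by simp only [term, dif_neg hj]
        obtain ⟨i, hi, -⟩ := hb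
        rw [this] at hi
        simp at hi
      have hmem : term j ∈ 𝒯 := by
        simp only [term, dif_pos hj]
        exact (e.symm ⟨j, hj⟩).2
      exact lt_of_lt_of_le hlt (ht _ hmem)
    · rw [helt]; exact (Classical.choose_spec hb).1
    · rw [helt]; exact (Classical.choose_spec hb).2

/-- **The DNF protocol, width form** (Karchmer–Wigderson 1990, §2): if `h` is a disjunction of
terms `⋀_{i ∈ T} x_i` over an arbitrary family `𝒯` of terms each of at most `d` of the `N`
variables, then Alice names her term as a `d`-tuple over the `N + 1` symbols "variable / blank"
(`k` bits whenever `(N+1)^d ≤ 2^k`) and Bob names a variable of it that is `0` in `b` (`t` bits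
whenever `N ≤ 2^t`): depth `≤ k + t`, i.e. `≤ d ⌈log₂ (N+1)⌉ + ⌈log₂ N⌉`.
[cite: KarchmerWigderson1990, §2] [cite: JuknaBFC2012, §3.3] -/
theorem exists_solvesMono_of_narrow_terms [Fintype ι] [Nonempty ι] (𝒯 : Set (Finset ι))
    (h : (ι → Bool) → Bool) (hh : ∀ a, h a = true ↔ ∃ T ∈ 𝒯, ∀ i ∈ T, a i = true) (d k t : ℕ)
    (hd : ∀ T ∈ 𝒯, T.card ≤ d) (hk : (Fintype.card ι + 1) ^ d ≤ 2 ^ k)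
    (ht : Fintype.card ι ≤ 2 ^ t) :
    ∃ P : KWTree ι, P.SolvesMono h ∧ P.depth ≤ k + t := by
  classical
  -- codes: coordinates ↔ `Fin N`, "coordinate or blank" ↔ `Fin (N+1)`, `d`-tuples ↔ `Fin ((N+1)^d)`
  have hcardO : Fintype.card (Option ι) = Fintype.card ι + 1 := Fintype.card_option
  let eO : Option ι ≃ Fin (Fintype.card ι + 1) := (Fintype.equivFin (Option ι)).trans (finCongr hcardO)
  let eI := Fintype.equivFin ι
  let tup : Finset ι → (Fin d → Option ι) := fun T l =>
    if hl : (l : ℕ) < T.card then some (T.equivFin.symm ⟨l, hl⟩ : ι) else none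
  let enc : (Fin d → Option ι) → ℕ := fun τ => (finFunctionFinEquiv (fun l => eO (τ l)) : ℕ)
  let term : ℕ → Finset ι := fun j =>
    if hj : j < (Fintype.card ι + 1) ^ d then
      Finset.univ.filter fun i => ∃ l, finFunctionFinEquiv.symm ⟨j, hj⟩ l = eO (some i)
    else ∅
  -- decoding the code of the tuple of a small finset gives the finset back
  have henc_lt : ∀ τ, enc τ < (Fintype.card ι + 1) ^ d := fun τ => Fin.isLt _
  have hterm : ∀ T : Finset ι, T.card ≤ d → term (enc (tup T)) = T := by
    intro T hT
    simp only [term, dif_pos (henc_lt (tup T))]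
    have hround : finFunctionFinEquiv.symm ⟨enc (tup T), henc_lt (tup T)⟩ = fun l => eO (tup T l) := by
      simp only [enc, Fin.eta, Equiv.symm_apply_apply]
    rw [hround]
    ext i
    simp only [Finset.mem_filter, Finset.mem_univ, true_and, EmbeddingLike.apply_eq_iff_eq]
    constructor
    · rintro ⟨l, hl⟩
      simp only [tup] at hl
      split_ifs at hl with hlt
      · simp only [Option.some.injEq] at hl
        rw [← hl]
        exact (T.equivFin.symm ⟨l, hlt⟩).2
    · intro hi
      have hlt : ((T.equivFin ⟨i, hi⟩ : Fin T.card) : ℕ) < d := lt_of_lt_of_le (Fin.isLt _) hT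
      refine ⟨⟨_, hlt⟩, ?_⟩
      simp only [tup, dif_pos (Fin.isLt _), Fin.eta, Equiv.symm_apply_apply]
  let cA : (ι → Bool) → ℕ := fun a =>
    if ha : ∃ T ∈ 𝒯, ∀ i ∈ T, a i = true then enc (tup (Classical.choose ha)) else 0
  let elt : ℕ → ℕ → ι := fun _ l =>
    if hl : l < Fintype.card ι then eI.symm ⟨l, hl⟩ else Classical.arbitrary ι
  let cB : ℕ → (ι → Bool) → ℕ := fun j b =>
    if hb : ∃ i ∈ term j, b i = false then (eI (Classical.choose hb) : ℕ) else 0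
  have hAterm : ∀ a (ha : ∃ T ∈ 𝒯, ∀ i ∈ T, a i = true),
      cA a < 2 ^ k ∧ term (cA a) = Classical.choose ha := by
    intro a ha
    have hcA : cA a = enc (tup (Classical.choose ha)) := by simp only [cA, dif_pos ha]
    rw [hcA]
    exact ⟨lt_of_lt_of_le (henc_lt _) hk, hterm _ (hd _ (Classical.choose_spec ha).1)⟩
  refine exists_solvesMono_of_choice h k t term cA cB elt ?_ ?_ ?_
  · intro a ha
    have ha' := (hh a).mp ha
    obtain ⟨hlt, hT⟩ := hAterm a ha'
    refine ⟨hlt, ?_⟩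
    rw [hT]
    exact (Classical.choose_spec ha').2
  · intro a b ha hb
    have ha' := (hh a).mp ha
    obtain ⟨-, hT⟩ := hAterm a ha'
    rw [hT]
    by_contra hcon
    push Not at hcon
    have hb' : h b = true :=
      (hh b).mpr ⟨_, (Classical.choose_spec ha').1, fun i hi => by simpa using hcon i hi⟩
    rw [hb] at hb'
    exact Bool.false_ne_true hb'
  · intro j b hb
    have hcB : cB j b = (eI (Classical.choose hb) : ℕ) := by simp only [cB, dif_pos hb]
    have hlt : cB j b < Fintype.card ι := by rw [hcB]; exact Fin.isLt _
    have helt : elt j (cB j b) = Classical.choose hb := by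
      simp only [elt, dif_pos hlt]
      have : (⟨cB j b, hlt⟩ : Fin (Fintype.card ι)) = eI (Classical.choose hb) := Fin.ext hcB
      rw [this, Equiv.symm_apply_apply]
    refine ⟨lt_of_lt_of_le hlt ht, ?_, ?_⟩
    · rw [helt]; exact (Classical.choose_spec hb).1
    · rw [helt]; exact (Classical.choose_spec hb).2

/-! ### The send-your-input protocol -/

/-- For a MONOTONE `h`, a `1`-input `a` and a `0`-input `b` always have a coordinate with
`a i = 1`, `b i = 0` (else `a ≤ b` and `h a ≤ h b`). [folklore] -/
theorem exists_coord_of_monotone {h : (ι → Bool) → Bool} (hmono : Monotone h) {a b : ι → Bool}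
    (ha : h a = true) (hb : h b = false) : ∃ i, a i = true ∧ b i = false := by
  by_contra hcon
  push Not at hcon
  have hab : a ≤ b := by
    intro i
    cases hai : a i
    · exact Bool.false_le _
    · have := hcon i hai
      simp only [ne_eq, Bool.not_eq_false] at this
      rw [this]
  have := hmono hab
  rw [ha, hb] at this
  exact absurd this (by decide)

/-- **The send-your-input protocol**: for a monotone `h` on a finite coordinate set of size
`N ≤ 2^t`, Alice sends her whole input (`N` bits) and Bob names a coordinate with `a i = 1`,
`b i = 0` (`t` bits): the monotone KW game of `h` has a protocol of depth `≤ N + t`.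
[cite: KarchmerWigderson1990, §2] [folklore] -/
theorem exists_solvesMono_of_monotone [Fintype ι] [Nonempty ι] (h : (ι → Bool) → Bool)
    (hmono : Monotone h) (t : ℕ) (ht : Fintype.card ι ≤ 2 ^ t) :
    ∃ P : KWTree ι, P.SolvesMono h ∧ P.depth ≤ Fintype.card ι + t := by
  classical
  -- Alice's number: the code of `a`; Bob decodes it and answers with the code of a coordinate
  let eA := Fintype.equivFin (ι → Bool)
  let eI := Fintype.equivFin ι
  have hcardA : Fintype.card (ι → Bool) = 2 ^ Fintype.card ι := by simp
  let dec : ℕ → (ι → Bool) := fun j =>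
    if hj : j < Fintype.card (ι → Bool) then eA.symm ⟨j, hj⟩ else fun _ => true
  let term : ℕ → Finset ι := fun j => Finset.univ.filter fun i => dec j i = true
  let cA : (ι → Bool) → ℕ := fun a => (eA a : ℕ)
  let elt : ℕ → ℕ → ι := fun _ l => if hl : l < Fintype.card ι then eI.symm ⟨l, hl⟩ else Classical.arbitrary ι
  let cB : ℕ → (ι → Bool) → ℕ := fun j b =>
    if hb : ∃ i ∈ term j, b i = false then (eI (Classical.choose hb) : ℕ) else 0
  have hdec : ∀ a, dec (cA a) = a := by
    intro a
    simp only [dec, cA, dif_pos (Fin.isLt _), Fin.eta, Equiv.symm_apply_apply]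
  refine exists_solvesMono_of_choice h (Fintype.card ι) t term cA cB elt ?_ ?_ ?_
  · intro a _
    refine ⟨?_, ?_⟩
    · change (eA a : ℕ) < 2 ^ Fintype.card ι
      rw [← hcardA]
      exact (eA a).isLt
    · intro i hi
      simp only [term, Finset.mem_filter, Finset.mem_univ, true_and] at hi
      rwa [hdec] at hi
  · intro a b ha hb
    obtain ⟨i, hai, hbi⟩ := exists_coord_of_monotone hmono ha hb
    refine ⟨i, ?_, hbi⟩
    simp only [term, Finset.mem_filter, Finset.mem_univ, true_and]
    rw [hdec]; exact hai
  · intro j b hb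
    have hcB : cB j b = (eI (Classical.choose hb) : ℕ) := by simp only [cB, dif_pos hb]
    have hlt : cB j b < Fintype.card ι := by rw [hcB]; exact Fin.isLt _
    have helt : elt j (cB j b) = Classical.choose hb := by
      simp only [elt, dif_pos hlt]
      have : (⟨cB j b, hlt⟩ : Fin (Fintype.card ι)) = eI (Classical.choose hb) := Fin.ext hcB
      rw [this, Equiv.symm_apply_apply]
    refine ⟨lt_of_lt_of_le hlt ht, ?_, ?_⟩
    · rw [helt]; exact (Classical.choose_spec hb).1
    · rw [helt]; exact (Classical.choose_spec hb).2

end KWTree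

end Literature.Computability.Complexity
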